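import Mathlib.Algebra.Homology.Linear
import Mathlib.Algebra.Homology.ShortComplex.Linear
import Literature.NumberTheory.Automorphic.ArithmeticQuotientHeckeLocal
import Literature.NumberTheory.Automorphic.HeckeDoubleCosetOperators
import Literature.NumberTheory.Automorphic.CompletedCohomologyHeckeAlgebraGLnHolds
import Literature.NumberTheory.Automorphic.AdicCompletionLocalField
import Literature.NumberTheory.Automorphic.ReductiveGroupData
import HarnessLib

/-!
# Mod `p` Hecke eigensystems of `GL_N` over a number field: `H^i(X_K, k)` as a module over the
spherical Hecke algebras `ℋ(GL_N(F_v), GL_N(𝒪_v); k)` and characters occurring in cohomology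

Topic `NumberTheory/Automorphic`, namespace `Literature.NumberTheory.Automorphic` (abstract part
under `ArithmeticQuotient`, complementing `ArithmeticQuotientCohomology` and
`ArithmeticQuotientHeckeLocal`; `GL_N` part under `ModPHeckeEigensystemGL`).  A DEFINITION file:
no named fact, no open problem.

## What is typed, and from where

* [Scholze2015, §V.4] (arXiv:1306.2070, pp. 66–67):
  `X_K = GL_n(F)\[(GL_n(F ⊗ ℝ)/ℝ_{>0}K_∞) × GL_n(𝔸_{F,f})/K]` regarded as a stack when `K` is not
  small; `𝕋_{F,S} = ⊗_{v ∉ S} 𝕋_v`, `𝕋_v = ℤ_p[GL_n(F_v)//GL_n(𝒪_{F_v})]`; "Recall that there is a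
  canonical action of `𝕋_{F,S}` on `H^i(X_K, ℳ_{ξ,K})`";
  `𝕋_{F,S}(K, ξ, i, m) = im(𝕋_{F,S} → End(H^i(X_K, ℳ_{ξ,K}/p^m)))` (Thm. V.4.1);
  "`ψ : 𝕋_{F,S} → 𝔽̄_p` a system of Hecke eigenvalues such that the `ψ`-eigenspace
  `H^i(X_K, ⋯)[ψ] ≠ 0`" (Cor. V.4.3).
* [TreumannVenkatesh2016] (arXiv:1407.2346): §2.10 (p. 8) the Hecke algebra `ℋ(G, K)` with `k`
  coefficients, `V^K = Hom_G(k[G/K], V)` "gives the `K`-invariants of a left `G`-module the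
  structure of a right `ℋ(G,K)`-module", and (Heckerightact) `xK ∗ h = ∑_{gK ∈ G/K} xgK · h(K, gK)`;
  §2.11 the resulting left action on the cohomology of `X/K`; §5, Def. 2 (p. 15)
  `[G]_K = G(F)\G(𝔸)/K_∞K` ("for general `K`, one should regard `[G]_K` as an orbifold"),
  `ℋ(G(𝔸_f), K) = ⊗'_v ℋ(G_v, K_v)` (restricted w.r.t. the units), `ℋ_V := ⊗'_{v ∈ V}`; §5.2
  "`χ` appears in the cohomology of `[G]_K` if there is `h ∈ H^*([G]_K)` such that `h` transforms
  under `ℋ(G_V, K_V)` by `χ`"; §1.1 "mod `p` automorphic forms = Hecke eigenclasses in the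
  cohomology of congruence subgroups with `k`-coefficients"; Thm. 5 (§5.5, First Main Theorem)
  is stated in these terms.

## Contents

Abstract part (a place datum `(Gᵥ, Kᵥ, ιᵥ : Gᵥ →* 𝒢, πᵥ : 𝒢 →* Gᵥ)`, a level `L ≤ 𝒢` unramified
at it — `ArithmeticQuotient.IsUnramifiedLevel` of `ArithmeticQuotientHeckeLocal` —, coefficients
`M`, and `ι : Γ →* 𝒢`):
* `ArithmeticQuotient.localHeckeFun k M Kᵥ ιᵥ L : ℋ(Gᵥ, Kᵥ) →ₗ[k] End_k Fun(𝒢 ⧸ L, M)` — the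
  operator of `T ∈ ℋ(Gᵥ, Kᵥ) = End_{Gᵥ}(k[Gᵥ ⧸ Kᵥ])` (`heckeAlgebra`):
  `(T f)(xL) = ∑_{yKᵥ} (T [Kᵥ])(yKᵥ) · f(x ιᵥ(y) L)` (`heckeAlgebra.toVector T = T [Kᵥ]`), through
  the auxiliary `evalSum`, `vecAct`;
* under `h : IsUnramifiedLevel Kᵥ ιᵥ πᵥ L` (all proved): independence of representatives
  (`vecAct_apply_mk`), `Γ`-equivariance (`vecAct_comp_smul`), `1 ↦ id` (`localHeckeFun_one`), the
  reversed product rule `(T S) ↦ S ∘ T` (`localHeckeFun_mul`), agreement of the double-coset basis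
  element `T_{KᵥaKᵥ}` with the tree's `heckeFun k L (ιᵥ a) M` (`localHeckeFun_doubleCosetOperator`),
  and commutation of two orthogonal places (`localHeckeFun_comm_of_orthogonal`);
* on cohomology: `h.localHeckeRepHom M ι T` (endomorphism of the `Γ`-representation `coeffRep`),
  `h.localHeckeEnd M ι T i ∈ End_k H^i(X_L, M)` and the `k`-algebra homomorphism
  `h.localHeckeAlgHom M ι i : ℋ(Gᵥ, Kᵥ)ᵐᵒᵖ →ₐ[k] End_k H^i(X_L, M)` (with
  `groupCohomology_map_id_smul`: `Hⁿ(Γ, -)` is `k`-linear on morphisms, a small complement to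
  Mathlib; additivity as in `TwistedQuotient.map_id_add` of `CuspidalCohomologyGLShapiroSum`).

`GL_N` part (`F` a number field, `N : ℕ`, `k` a commutative ring, a level
`K ≤ GL_N(𝔸_F^∞) = BigHeckeGLn.FiniteAdelicGL N F`, `V` a SET of finite places at which the Hecke
algebras act; the place datum at `v` is
`(GL_N(F_v), GL_N(𝒪_v) = glInt N F_v, BigHeckeGLn.ofLocal, BigHeckeGLn.localComponent)`):
* `ModPHeckeEigensystemGL.localHeckeAlgebra N F k v = ℋ(GL_N(F_v), GL_N(𝒪_v); k)`,
  `HeckeCharacter N F k` (families `θ_v : ℋ_v →ₐ[k] k` = `k`-characters of `⊗'_v ℋ_v`),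
  `cohomology N F k K i = H^i(X_K, k)`, `IsMaximalOn N F V K` (`K = K^V · ∏_{v ∈ V} GL_N(𝒪_v)`,
  Scholze's `K = K_S K^S` with `V = {v ∉ S}`), `heckeEnd N F k K v T i` (the operator of `T ∈ ℋ_v`
  on `H^i(X_K, k)`; junk `0` where `K` is not maximal), `heckeAlgHom` (the algebra homomorphisms
  `ℋ_vᵐᵒᵖ →ₐ[k] End_k H^i(X_K, k)`, `v ∈ V`), `heckeImage N F k V K i` (Scholze's `𝕋(K, i)`), with
  `heckeEnd_one/add/smul/mul`, `heckeEnd_comm_of_ne`, `heckeEnd_doubleCosetOperator`;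
* `structure ModPHeckeEigensystemGL N F k V K i` (a character with a non-zero eigenclass in
  `H^i(X_K, k)`), `ModPHeckeEigensystemGL.OccursInDegree N F k V K i θ`,
  `ModPHeckeEigensystemGL.OccursIn N F k V K θ` (some degree), with `occursInDegree_iff`,
  monotonicity in `V`, `congr`, and `OccursInDegree.isMaximalOn`.

## Conventions (checked against the sources and the tree)

* The operator of the basis element `T_{KaK}` (`T [K] = 𝟙_{KaK}`,
  `heckeAlgebra.doubleCosetOperator`) is `f ↦ (xL ↦ ∑_{yK ⊆ KaK} f(x ιᵥ(y) L))`: this is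
  (Heckerightact) of [TreumannVenkatesh2016, §2.10] on the chains `k[X/K]` transposed to cochains
  (§2.11), the operator `π(𝟙_{KaK}) = ∑_{yK ⊆ KaK} π(y)` of the convolution algebra `C_c(K\G/K)`
  (`HeckeAlgebra`: `heckeOperator`, `heckeOperator_apply_eq_integral`) — Scholze's `𝕋_v` — and the
  tree's `ArithmeticQuotient.heckeFun k L (ιᵥ a) M` (`localHeckeFun_doubleCosetOperator`), hence
  the operator `T^{(j)}_v` of `HeckeEigenvaluesOccurGL` (`ScholzeTorsionGalois`) and of
  `BigHeckeGLn`.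
* `T ↦ T|H^i` reverses products (`localHeckeEnd_mul`): `H^i` is a RIGHT module over
  `heckeAlgebra = End_G(k[G ⧸ K])` (Frobenius reciprocity, exactly as
  `heckeAlgebra.fixedPointsAlgHom` of `HeckeAlgebraFixedPointsProofs`), i.e. a left module over
  `heckeAlgebraᵐᵒᵖ ≅ C_c(K\G/K)`; the algebra homomorphisms are therefore out of `ᵐᵒᵖ`.  Characters
  of `A` and of `Aᵐᵒᵖ` with values in the commutative `k` coincide, and `ℋ(GL_N(F_v), GL_N(𝒪_v); k)`
  is commutative (Gelfand's trick, `IsGelfandPair.of_antiInvolution`), so for eigensystems the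
  distinction is immaterial; the eigen-equation reads `heckeEnd K v T i c = θ_v(T) • c`.
* A `k`-character of `⊗'_{v ∈ V} ℋ_v` is typed as a family `(θ_v)_v` over all places, used only at
  `v ∈ V`.
* `V` is an arbitrary `Set` of finite places (Treumann–Venkatesh allow any set of good places,
  e.g. infinite with finite complement, or finite); Scholze's setting is `V = {v ∉ S}` for a
  `Finset S` (`(↑S)ᶜ`).

## Design notes / what is NOT here

* `heckeEnd` is total in `(K, v)` with the documented junk value `0` off maximal places, so that
  `OccursInDegree` needs no proof argument; occurrence then IMPLIES `IsMaximalOn V K`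
  (`OccursInDegree.isMaximalOn`).
* `H^i(X_K, k)` is the group-cohomology (stack) model of `ArithmeticQuotientCohomology`, as
  everywhere in the tree; the comparison with the singular cohomology of the manifold/orbifold
  `X_K` for neat `K` (and Treumann–Venkatesh's orbifold cohomology for non-neat `K`) is not
  formalised (cf. [TreumannVenkatesh2016, §5.2, Prop. 3]: one may shrink `K` away from `V`).
* The restricted tensor product `⊗'_v ℋ_v` is not built as an algebra; its action is the
  commuting family of algebra homomorphisms `heckeAlgHom` (`heckeEnd_comm_of_ne`; the same place
  commutes given `IsGelfandPair`, `heckeEnd_comm_of_isGelfandPair` — the `GL_N` instance of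
  `IsGelfandPair` over a general `k` is Gelfand's trick with the transpose and the Cartan
  decomposition, available in the Satake files, not imported here) and its image is `heckeImage`.
  The Hecke-pair instance `IsHeckeTriple ⊤ (glInt N F_v) (glInt N F_v)` (compact open) is
  `isHeckeTriple_glInt` of `SatakeParametersGLIsoProofs` (with `AdicCompletionLocalField`), taken
  as an instance argument where double-coset operators are mentioned.
* Not here: the theorems (Scholze's Thm. V.4.1 / Cor. V.4.3, cf.
  `Scholze2015_galoisRep_of_modPEigensystem` of `ScholzeTorsionGalois`; Treumann–Venkatesh's
  Thm. 5), non-trivial weights `ξ`, compactly supported / boundary cohomology, and the comparison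
  `OccursInDegree ↔ HeckeEigenvaluesOccurGL` (immediate from `heckeEnd_doubleCosetOperator` once
  the Satake files are imported).

## References

* P. Scholze, *On torsion in the cohomology of locally symmetric varieties*, Ann. of Math. (2)
  182 (2015), 945–1066; arXiv:1306.2070, §V.4 (pp. 66–67), Thm. V.4.1, Cor. V.4.3 [Scholze2015].
* D. Treumann, A. Venkatesh, *Functoriality, Smith theory, and the Brauer homomorphism*, Ann. of
  Math. (2) 183 (2016), 177–228; arXiv:1407.2346, §1.1, §2.10–2.11 (p. 8), §5 Def. 2, §5.1–5.2
  (p. 15), Thm. 5 (p. 17) [TreumannVenkatesh2016].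
* C. Khare, J. Thorne, *Potential automorphy and the Leopoldt conjecture*, Amer. J. Math. 139
  (2017), §6.2 (the action of `ℋ(G(F_v), U_v)` on `H^*(X_U, M)`) [KhareThorne2017].
-/

noncomputable section

open MulAction CategoryTheory MonoidAlgebra Representation

universe u

namespace Literature.NumberTheory.Automorphic

/-! ### `k`-linearity of `Hⁿ(Γ, -)` on morphisms (complement to Mathlib) -/

section Linear

variable {k : Type u} [CommRing k] {Γ : Type u} [Group Γ]

/-- Homology of homological complexes in a `k`-linear category is `k`-linear on morphisms:
`H(r • φ) = r • H(φ)` (the analogue of Mathlib's `HomologicalComplex.homologyMap_neg/add/sub`,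
listed as a TODO in `Mathlib/Algebra/Homology/Linear.lean`; from `ShortComplex.homologyMap_smul`).
[folklore] -/
theorem homologicalComplex_homologyMap_smul {C : Type*} [Category C] [Preadditive C]
    [Linear k C] {ι' : Type*} {c : ComplexShape ι'} {K L : HomologicalComplex C c} (r : k)
    (φ : K ⟶ L) (i : ι') [K.HasHomology i] [L.HasHomology i] :
    HomologicalComplex.homologyMap (r • φ) i = r • HomologicalComplex.homologyMap φ i := by
  have hsc : (HomologicalComplex.shortComplexFunctor C c i).map (r • φ) =
      r • (HomologicalComplex.shortComplexFunctor C c i).map φ := rfl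
  change ShortComplex.homologyMap ((HomologicalComplex.shortComplexFunctor C c i).map (r • φ)) =
    r • ShortComplex.homologyMap ((HomologicalComplex.shortComplexFunctor C c i).map φ)
  rw [hsc, ShortComplex.homologyMap_smul]

/-- The map induced on inhomogeneous cochains is `k`-linear in the morphism of representations.
[folklore] -/
theorem groupCohomology_cochainsMap_id_smul {A B : Rep k Γ} (r : k) (φ : A ⟶ B) :
    groupCohomology.cochainsMap (MonoidHom.id Γ) (r • φ) =
      r • groupCohomology.cochainsMap (MonoidHom.id Γ) φ := by
  refine HomologicalComplex.hom_ext _ _ fun n => ModuleCat.hom_ext (LinearMap.ext fun x => ?_)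
  rfl

/-- **`Hⁿ(Γ, -)` is `k`-linear on morphisms**: `Hⁿ(r • φ) = r • Hⁿ(φ)`. [folklore] -/
theorem groupCohomology_map_id_smul {A B : Rep k Γ} (r : k) (φ : A ⟶ B) (n : ℕ) :
    groupCohomology.map (MonoidHom.id Γ) (r • φ) n =
      r • groupCohomology.map (MonoidHom.id Γ) φ n := by
  change (HomologicalComplex.homologyMap (groupCohomology.cochainsMap (MonoidHom.id Γ) (r • φ)) n :
      (groupCohomology.inhomogeneousCochains A).homology n ⟶
        (groupCohomology.inhomogeneousCochains B).homology n) =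
    r • HomologicalComplex.homologyMap (groupCohomology.cochainsMap (MonoidHom.id Γ) φ) n
  rw [groupCohomology_cochainsMap_id_smul, homologicalComplex_homologyMap_smul]

end Linear

namespace ArithmeticQuotient

variable {k : Type u} [CommRing k] {𝒢 : Type u} [Group 𝒢] {M : Type u} [AddCommGroup M] [Module k M]
variable {Gᵥ : Type*} [Group Gᵥ] (Kᵥ : Subgroup Gᵥ) (ιᵥ : Gᵥ →* 𝒢) (L : Subgroup 𝒢)

/-! ### The action of `k[Gᵥ ⧸ Kᵥ]` and of `ℋ(Gᵥ, Kᵥ)` on `Fun(𝒢 ⧸ L, M)` -/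

section VecAct

variable (k M)

/-- Evaluation sums: for `f : 𝒢 ⧸ L → M` and `x ∈ 𝒢`, the `k`-linear map
`k[Gᵥ ⧸ Kᵥ] → M`, `t = ∑ t(y) [yKᵥ] ↦ ∑_y t(y) • f(x ιᵥ(ỹ) L)` (`ỹ = Quotient.out y`; the value
`f(x ιᵥ(ỹ) L)` does not depend on the representative `ỹ` as soon as `ιᵥ(Kᵥ) ≤ L`). [folklore] -/
def evalSum (f : 𝒢 ⧸ L → M) (x : 𝒢) : MonoidAlgebra k (Gᵥ ⧸ Kᵥ) →ₗ[k] M :=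
  Finsupp.linearCombination k (fun y : Gᵥ ⧸ Kᵥ => f ((x * ιᵥ y.out : 𝒢) : 𝒢 ⧸ L)) ∘ₗ
    (MonoidAlgebra.coeffLinearEquiv k).toLinearMap

/-- Unfolding of `evalSum` as a finite sum over the support. [folklore] -/
theorem evalSum_apply (f : 𝒢 ⧸ L → M) (x : 𝒢) (t : MonoidAlgebra k (Gᵥ ⧸ Kᵥ)) :
    evalSum k M Kᵥ ιᵥ L f x t =
      ∑ y ∈ t.coeff.support, t.coeff y • f ((x * ιᵥ y.out : 𝒢) : 𝒢 ⧸ L) := by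
  simp only [evalSum, LinearMap.coe_comp, LinearEquiv.coe_coe, Function.comp_apply,
    MonoidAlgebra.coeffLinearEquiv_apply, Finsupp.linearCombination_apply, Finsupp.sum]

/-- `evalSum` on a basis vector: `[yKᵥ] ↦ r • f(x ιᵥ(ỹ) L)`. [folklore] -/
@[simp]
theorem evalSum_single (f : 𝒢 ⧸ L → M) (x : 𝒢) (y : Gᵥ ⧸ Kᵥ) (r : k) :
    evalSum k M Kᵥ ιᵥ L f x (single y r) = r • f ((x * ιᵥ y.out : 𝒢) : 𝒢 ⧸ L) := by
  simp [evalSum, Finsupp.linearCombination_single]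

/-- **The operator of a vector `t ∈ k[Gᵥ ⧸ Kᵥ]` on `Fun(𝒢 ⧸ L, M)`**:
`(t • f)(c) = ∑_y t(y) • f(c̃ ιᵥ(ỹ) L)` with the chosen representative `c̃ = Quotient.out c`
(`evalSum` at `c̃`), `k`-linear in `t` and in `f`.  For `Kᵥ`-invariant `t` and a level `L`
unramified at `v` the value may be computed with any representative of `c`
(`IsUnramifiedLevel.vecAct_apply_mk`); otherwise it is a junk value. [folklore] -/
def vecAct : MonoidAlgebra k (Gᵥ ⧸ Kᵥ) →ₗ[k] Module.End k ((𝒢 ⧸ L) → M) where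
  toFun t :=
    { toFun := fun f c => evalSum k M Kᵥ ιᵥ L f c.out t
      map_add' := fun f f' => funext fun c => by
        simp only [evalSum_apply, Pi.add_apply, smul_add, Finset.sum_add_distrib]
      map_smul' := fun r f => funext fun c => by
        simp only [evalSum_apply, Pi.smul_apply, RingHom.id_apply, Finset.smul_sum, smul_comm r] }
  map_add' t t' := LinearMap.ext fun f => funext fun c => by
    simp only [map_add, LinearMap.coe_mk, AddHom.coe_mk, LinearMap.add_apply, Pi.add_apply]
  map_smul' r t := LinearMap.ext fun f => funext fun c => by
    simp only [map_smul, LinearMap.coe_mk, AddHom.coe_mk, RingHom.id_apply, LinearMap.smul_apply,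
      Pi.smul_apply]

/-- Unfolding of `vecAct`: `(t • f)(c) = evalSum f c̃ t`. [folklore] -/
theorem vecAct_apply (t : MonoidAlgebra k (Gᵥ ⧸ Kᵥ)) (f : 𝒢 ⧸ L → M) (c : 𝒢 ⧸ L) :
    vecAct k M Kᵥ ιᵥ L t f c = evalSum k M Kᵥ ιᵥ L f c.out t :=
  rfl

/-- **The operator of `T ∈ ℋ(Gᵥ, Kᵥ) = End_{Gᵥ}(k[Gᵥ ⧸ Kᵥ])` on `Fun(𝒢 ⧸ L, M)`**: the operator
`vecAct` of the `Kᵥ`-invariant vector `T [Kᵥ] = ∑_y t(y) [yKᵥ]` (`heckeAlgebra.toVector`), i.e.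
`(T • f)(xL) = ∑_{yKᵥ} t(yKᵥ) • f(x ιᵥ(y) L)` (with any representative `x` of `xL` when `L` is
unramified at `v`, `IsUnramifiedLevel.localHeckeFun_apply_mk`; with the chosen one in general,
a junk value) — for the double-coset operator `T_{KᵥaKᵥ}`
(`t = 𝟙_{KᵥaKᵥ}`) this is `∑_{yKᵥ ⊆ KᵥaKᵥ} f(x ιᵥ(y) L)`, the tree's `heckeFun k L (ιᵥ a) M`
(`IsUnramifiedLevel.localHeckeFun_doubleCosetOperator`).  This is the action through which the
local Hecke algebra at an unramified place acts on functions on `𝒢 ⧸ L` and on `H^*(X_L, M)`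
([Scholze2015, §V.4]: "canonical action of `𝕋_{F,S} = ⊗_{v ∉ S} 𝕋_v` on `H^i(X_K, ·)`";
[TreumannVenkatesh2016, §2.10 (Heckerightact), §2.11]: `xK ∗ h = ∑_{gK} h(K, gK) xgK` on chains,
transposed to cochains; [KhareThorne2017, §6.2]).  It reverses the order of products
(`IsUnramifiedLevel.localHeckeFun_mul`), i.e. it is a left action of `ℋ(Gᵥ, Kᵥ)ᵐᵒᵖ`, the
convolution algebra `C_c(Kᵥ\Gᵥ/Kᵥ; k)` (module docstring).
[cite: TreumannVenkatesh2016, §2.10–2.11] -/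
def localHeckeFun : heckeAlgebra k Gᵥ Kᵥ →ₗ[k] Module.End k ((𝒢 ⧸ L) → M) :=
  vecAct k M Kᵥ ιᵥ L ∘ₗ heckeAlgebra.toVector Kᵥ

/-- Unfolding of `localHeckeFun`. [folklore] -/
theorem localHeckeFun_apply (T : heckeAlgebra k Gᵥ Kᵥ) :
    localHeckeFun k M Kᵥ ιᵥ L T = vecAct k M Kᵥ ιᵥ L (heckeAlgebra.toVector Kᵥ T) :=
  rfl

variable {k M Kᵥ ιᵥ L}

/-- `evalSum` of a left translate `γ • f`, `(γ • f)(c) = f(γ⁻¹ c)`, is `evalSum` of `f` at `γ⁻¹ x`.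
[folklore] -/
theorem evalSum_comp_smul (f : 𝒢 ⧸ L → M) (g x : 𝒢) (t : MonoidAlgebra k (Gᵥ ⧸ Kᵥ)) :
    evalSum k M Kᵥ ιᵥ L (fun c => f (g • c)) x t = evalSum k M Kᵥ ιᵥ L f (g * x) t := by
  simp only [evalSum_apply, MulAction.Quotient.smul_coe, smul_eq_mul, mul_assoc]

end VecAct

/-! ### Unramified levels: independence of representatives, the algebra structure -/

namespace IsUnramifiedLevel

variable {Kᵥ ιᵥ L} {πᵥ : 𝒢 →* Gᵥ} (h : IsUnramifiedLevel Kᵥ ιᵥ πᵥ L)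
include h

/-- `x ιᵥ(a) L = x ιᵥ(b) L` when `a Kᵥ = b Kᵥ` (as `ιᵥ(Kᵥ) ≤ L`). [folklore] -/
theorem mk_mul_map_eq_of_mk_eq (x : 𝒢) {a b : Gᵥ} (hab : (a : Gᵥ ⧸ Kᵥ) = b) :
    ((x * ιᵥ a : 𝒢) : 𝒢 ⧸ L) = ((x * ιᵥ b : 𝒢) : 𝒢 ⧸ L) := by
  rw [QuotientGroup.eq, mul_inv_rev, mul_assoc, inv_mul_cancel_left, ← map_inv, ← map_mul]
  exact h.map_mem (QuotientGroup.eq.1 hab)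

/-- `x ιᵥ((g • y)~) L = x ιᵥ(g) ιᵥ(ỹ) L`: representatives of translated cosets. [folklore] -/
theorem mk_mul_map_out_smul (x : 𝒢) (g : Gᵥ) (y : Gᵥ ⧸ Kᵥ) :
    ((x * ιᵥ (g • y).out : 𝒢) : 𝒢 ⧸ L) = ((x * ιᵥ g * ιᵥ y.out : 𝒢) : 𝒢 ⧸ L) := by
  rw [mul_assoc, ← map_mul]
  refine h.mk_mul_map_eq_of_mk_eq x ?_
  change ((g • y).out : Gᵥ ⧸ Kᵥ) = g • ((y.out : Gᵥ) : Gᵥ ⧸ Kᵥ)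
  rw [QuotientGroup.out_eq', QuotientGroup.out_eq']

/-- **Translation of the vector is right translation of the base point**:
`evalSum f x (g • t) = evalSum f (x ιᵥ(g)) t` for `g ∈ Gᵥ`. [folklore] -/
theorem evalSum_ofMulAction (f : 𝒢 ⧸ L → M) (x : 𝒢) (g : Gᵥ) (t : MonoidAlgebra k (Gᵥ ⧸ Kᵥ)) :
    evalSum k M Kᵥ ιᵥ L f x (ofMulAction k Gᵥ (Gᵥ ⧸ Kᵥ) g t) =
      evalSum k M Kᵥ ιᵥ L f (x * ιᵥ g) t := by
  have hcoeff : (ofMulAction k Gᵥ (Gᵥ ⧸ Kᵥ) g t).coeff = Finsupp.mapDomain (g • ·) t.coeff := by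
    simp [ofMulAction_def]
  simp only [evalSum, LinearMap.coe_comp, LinearEquiv.coe_coe, Function.comp_apply,
    MonoidAlgebra.coeffLinearEquiv_apply, hcoeff, Finsupp.linearCombination_mapDomain]
  congr 2
  funext y
  simp only [Function.comp_apply, h.mk_mul_map_out_smul]

/-- **Changing the representative of the base point by `l ∈ L`** translates the vector by the
`v`-component `πᵥ(l) ∈ Kᵥ`: `evalSum f (x l) t = evalSum f x (πᵥ(l) • t)`. [folklore] -/
theorem evalSum_mul_of_mem (f : 𝒢 ⧸ L → M) (x : 𝒢) {l : 𝒢} (hl : l ∈ L)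
    (t : MonoidAlgebra k (Gᵥ ⧸ Kᵥ)) :
    evalSum k M Kᵥ ιᵥ L f (x * l) t =
      evalSum k M Kᵥ ιᵥ L f x (ofMulAction k Gᵥ (Gᵥ ⧸ Kᵥ) (πᵥ l) t) := by
  rw [h.evalSum_ofMulAction]
  simp only [evalSum, LinearMap.coe_comp, LinearEquiv.coe_coe, Function.comp_apply]
  congr 2
  funext y
  rw [mul_assoc, mul_assoc]
  congr 1
  change x • ((l * ιᵥ y.out : 𝒢) : 𝒢 ⧸ L) = x • ((ιᵥ (πᵥ l) * ιᵥ y.out : 𝒢) : 𝒢 ⧸ L)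
  rw [h.mk_mul_map l hl y.out, map_mul]

/-- **Independence of the representative.** For a `Kᵥ`-invariant vector `t` and a level
unramified at `v`, `(t • f)(xL) = ∑_y t(y) • f(x ιᵥ(ỹ) L)` for ANY representative `x`.
[folklore] -/
theorem vecAct_apply_mk {t : MonoidAlgebra k (Gᵥ ⧸ Kᵥ)}
    (ht : ∀ κ ∈ Kᵥ, ofMulAction k Gᵥ (Gᵥ ⧸ Kᵥ) κ t = t) (f : 𝒢 ⧸ L → M) (x : 𝒢) :
    vecAct k M Kᵥ ιᵥ L t f (x : 𝒢 ⧸ L) = evalSum k M Kᵥ ιᵥ L f x t := by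
  rw [vecAct_apply]
  obtain ⟨l, hl⟩ := QuotientGroup.mk_out_eq_mul L x
  rw [hl, h.evalSum_mul_of_mem f x l.2, ht _ (h.apply_mem l.2)]

/-- The operator of `T ∈ ℋ(Gᵥ, Kᵥ)` computed with any representative:
`(T • f)(xL) = evalSum f x (T [Kᵥ])`. [folklore] -/
theorem localHeckeFun_apply_mk (T : heckeAlgebra k Gᵥ Kᵥ) (f : 𝒢 ⧸ L → M) (x : 𝒢) :
    localHeckeFun k M Kᵥ ιᵥ L T f (x : 𝒢 ⧸ L) =
      evalSum k M Kᵥ ιᵥ L f x (heckeAlgebra.toVector Kᵥ T) :=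
  h.vecAct_apply_mk (fun _ hκ => heckeAlgebra.ofMulAction_toVector Kᵥ T hκ) f x

/-- **`Γ`-equivariance**: the operator of an invariant vector commutes with left translations
`(g • f)(c) = f(g⁻¹ c)` of functions on `𝒢 ⧸ L` (left and right multiplication commute).
[folklore] -/
theorem vecAct_comp_smul {t : MonoidAlgebra k (Gᵥ ⧸ Kᵥ)}
    (ht : ∀ κ ∈ Kᵥ, ofMulAction k Gᵥ (Gᵥ ⧸ Kᵥ) κ t = t) (f : 𝒢 ⧸ L → M) (g : 𝒢) :
    vecAct k M Kᵥ ιᵥ L t (fun c => f (g • c)) = fun c => vecAct k M Kᵥ ιᵥ L t f (g • c) := by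
  funext c
  induction c using QuotientGroup.induction_on with
  | H x =>
    rw [h.vecAct_apply_mk ht, MulAction.Quotient.smul_coe, smul_eq_mul, h.vecAct_apply_mk ht,
      evalSum_comp_smul]

/-- The operator of the unit vector `[Kᵥ]` is the identity (as `ιᵥ(Kᵥ) ≤ L`). [folklore] -/
theorem vecAct_single_one :
    vecAct k M Kᵥ ιᵥ L (single ((1 : Gᵥ) : Gᵥ ⧸ Kᵥ) 1) = LinearMap.id := by
  refine LinearMap.ext fun f => funext fun c => ?_
  rw [vecAct_apply, evalSum_single, one_smul, LinearMap.id_apply]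
  obtain ⟨κ, hκ⟩ := QuotientGroup.mk_out_eq_mul Kᵥ (1 : Gᵥ)
  rw [hκ, one_mul, QuotientGroup.mk_mul_of_mem _ (h.map_mem κ.2), QuotientGroup.out_eq']

/-- `1 ∈ ℋ(Gᵥ, Kᵥ)` acts as the identity. [folklore] -/
theorem localHeckeFun_one : localHeckeFun k M Kᵥ ιᵥ L 1 = LinearMap.id := by
  rw [localHeckeFun_apply, heckeAlgebra.toVector_one, h.vecAct_single_one]

/-- **The product rule (order reversed)**: `(T S) • f = S • (T • f)` on `Fun(𝒢 ⧸ L, M)` — the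
operators define a RIGHT `ℋ(Gᵥ, Kᵥ)`-module structure, i.e. a left module over `ℋ(Gᵥ, Kᵥ)ᵐᵒᵖ`
(Frobenius reciprocity: `V^K = Hom_G(k[G ⧸ K], V)` is a right `End_G(k[G ⧸ K])`-module,
[TreumannVenkatesh2016, §2.10]; compare `heckeAlgebra.fixedPointsAlgHom`).  Proof: with
`(T S)[K] = ∑_γ s(γ) γ̃ • (T [K])` (`heckeAlgebra.toVector_mul_eq_sum`) and
`evalSum f x (γ̃ • t) = evalSum f (x ιᵥ(γ̃)) t`. [cite: TreumannVenkatesh2016, §2.10] -/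
theorem localHeckeFun_mul (T S : heckeAlgebra k Gᵥ Kᵥ) :
    localHeckeFun k M Kᵥ ιᵥ L (T * S) =
      localHeckeFun k M Kᵥ ιᵥ L S ∘ₗ localHeckeFun k M Kᵥ ιᵥ L T := by
  refine LinearMap.ext fun f => funext fun c => ?_
  induction c using QuotientGroup.induction_on with
  | H x =>
    rw [LinearMap.comp_apply, h.localHeckeFun_apply_mk, h.localHeckeFun_apply_mk,
      heckeAlgebra.toVector_mul_eq_sum, map_sum, evalSum_apply]
    refine Finset.sum_congr rfl fun γ _ => ?_
    rw [map_smul, h.evalSum_ofMulAction, ← h.localHeckeFun_apply_mk]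

/-- **Consistency with the double-coset operators.**  For a Hecke pair `(Gᵥ, Kᵥ)` the operator of
the basis element `T_{KᵥaKᵥ}` of `ℋ(Gᵥ, Kᵥ)` (`heckeAlgebra.doubleCosetOperator`,
`T [Kᵥ] = 𝟙_{KᵥaKᵥ}`)
is the tree's global double-coset operator `[L ιᵥ(a) L]` (`heckeFun k L (ιᵥ a) M`,
`(T f)(xL) = ∑_{hL ⊆ L ιᵥ(a) L} f(x h L) = ∑_{yKᵥ ⊆ KᵥaKᵥ} f(x ιᵥ(y) L)`,
`IsUnramifiedLevel.heckeFun_apply_eq_sum_local`), the operator through which the tree's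
`HeckeEigenvaluesOccurGL`, `BigHeckeGLn.heckeOnCohomology`, … are defined
([KhareThorne2017, §6.2]; [Scholze2015, §V.4]). [cite: KhareThorne2017, §6.2] -/
theorem localHeckeFun_doubleCosetOperator [IsHeckeTriple (⊤ : Submonoid Gᵥ) Kᵥ Kᵥ] (a : Gᵥ) :
    localHeckeFun k M Kᵥ ιᵥ L (heckeAlgebra.doubleCosetOperator Kᵥ a) = heckeFun k L (ιᵥ a) M := by
  refine LinearMap.ext fun f => funext fun c => ?_
  induction c using QuotientGroup.induction_on with
  | H x =>
    rw [h.localHeckeFun_apply_mk, heckeAlgebra.toVector_doubleCosetOperator,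
      heckeAlgebra.doubleCosetIndicator_eq_sum, map_sum,
      h.heckeFun_apply_eq_sum_local (finite_orbit_quotient Kᵥ a) f x]
    refine Finset.sum_congr rfl fun y _ => ?_
    rw [evalSum_single, one_smul]

end IsUnramifiedLevel

/-! ### Two different unramified places commute -/

section Orthogonal

variable {G₁ G₂ : Type*} [Group G₁] [Group G₂] {K₁ : Subgroup G₁} {K₂ : Subgroup G₂}
  {ι₁ : G₁ →* 𝒢} {π₁ : 𝒢 →* G₁} {ι₂ : G₂ →* 𝒢} {π₂ : 𝒢 →* G₂} {L : Subgroup 𝒢}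

variable (k M) in
/-- **The local Hecke algebras at two different unramified places commute** on `Fun(𝒢 ⧸ L, M)`:
if `L` is unramified at `v₁` and at `v₂` and the places are orthogonal (`π₂ ∘ ι₁ = 1`, so that
`ι₁(G₁)` and `ι₂(G₂)` commute elementwise), then `T₁ ∘ T₂ = T₂ ∘ T₁` for all `T₁ ∈ ℋ(G₁, K₁)`,
`T₂ ∈ ℋ(G₂, K₂)`; hence the (restricted) tensor product `⊗_v ℋ(Gᵥ, Kᵥ)` acts
([TreumannVenkatesh2016, §5, Def. 2]; [Scholze2015, §V.4]). [folklore] -/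
theorem localHeckeFun_comm_of_orthogonal (h₁ : IsUnramifiedLevel K₁ ι₁ π₁ L)
    (h₂ : IsUnramifiedLevel K₂ ι₂ π₂ L) (horth : ∀ y : G₁, π₂ (ι₁ y) = 1)
    (T₁ : heckeAlgebra k G₁ K₁) (T₂ : heckeAlgebra k G₂ K₂) :
    localHeckeFun k M K₁ ι₁ L T₁ ∘ₗ localHeckeFun k M K₂ ι₂ L T₂ =
      localHeckeFun k M K₂ ι₂ L T₂ ∘ₗ localHeckeFun k M K₁ ι₁ L T₁ := by
  refine LinearMap.ext fun f => funext fun c => ?_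
  induction c using QuotientGroup.induction_on with
  | H x =>
    simp only [LinearMap.comp_apply]
    rw [h₁.localHeckeFun_apply_mk, h₂.localHeckeFun_apply_mk, evalSum_apply, evalSum_apply]
    simp_rw [h₂.localHeckeFun_apply_mk, h₁.localHeckeFun_apply_mk, evalSum_apply, Finset.smul_sum]
    rw [Finset.sum_comm]
    refine Finset.sum_congr rfl fun z _ => Finset.sum_congr rfl fun y _ => ?_
    rw [smul_comm, mul_assoc, h₂.comm_of_apply_eq_one _ (horth y.out) z.out, ← mul_assoc]

end Orthogonal

/-! ### The action on `H^i(X_L, M)` -/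

namespace IsUnramifiedLevel

variable (M) {Kᵥ ιᵥ L} {πᵥ : 𝒢 →* Gᵥ} (h : IsUnramifiedLevel Kᵥ ιᵥ πᵥ L)
  {Γ : Type u} [Group Γ] (ι : Γ →* 𝒢)
include h

/-- The operator of `T ∈ ℋ(Gᵥ, Kᵥ)` as an endomorphism of the `Γ`-representation
`Fun(𝒢 ⧸ L, M)` of level `L` (`coeffRep`; `Γ`-equivariance: `vecAct_comp_smul`). [folklore] -/
def localHeckeRepHom (T : heckeAlgebra k Gᵥ Kᵥ) : coeffRep k ι L M ⟶ coeffRep k ι L M :=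
  Rep.ofHom ⟨localHeckeFun k M Kᵥ ιᵥ L T, fun γ => LinearMap.ext fun f =>
    h.vecAct_comp_smul (fun _ hκ => heckeAlgebra.ofMulAction_toVector Kᵥ T hκ) f (ι γ)⁻¹⟩

/-- Unfolding lemma for `localHeckeRepHom`. [folklore] -/
@[simp]
theorem localHeckeRepHom_hom_apply (T : heckeAlgebra k Gᵥ Kᵥ) (f : (𝒢 ⧸ L) → M) :
    (h.localHeckeRepHom M ι T).hom f = localHeckeFun k M Kᵥ ιᵥ L T f :=
  rfl

/-- `T ↦ localHeckeRepHom T` is additive. [folklore] -/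
theorem localHeckeRepHom_add (S T : heckeAlgebra k Gᵥ Kᵥ) :
    h.localHeckeRepHom M ι (S + T) = h.localHeckeRepHom M ι S + h.localHeckeRepHom M ι T :=
  Rep.hom_ext (Representation.IntertwiningMap.ext (map_add (localHeckeFun k M Kᵥ ιᵥ L) S T))

/-- `T ↦ localHeckeRepHom T` is `k`-homogeneous. [folklore] -/
theorem localHeckeRepHom_smul (r : k) (T : heckeAlgebra k Gᵥ Kᵥ) :
    h.localHeckeRepHom M ι (r • T) = r • h.localHeckeRepHom M ι T :=
  Rep.hom_ext (Representation.IntertwiningMap.ext (map_smul (localHeckeFun k M Kᵥ ιᵥ L) r T))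

/-- `localHeckeRepHom 1 = 𝟙`. [folklore] -/
theorem localHeckeRepHom_one : h.localHeckeRepHom M ι 1 = 𝟙 (coeffRep k ι L M) :=
  Rep.hom_ext (Representation.IntertwiningMap.ext (h.localHeckeFun_one (k := k) (M := M)))

/-- `localHeckeRepHom (T S) = localHeckeRepHom T ≫ localHeckeRepHom S` (order reversed).
[folklore] -/
theorem localHeckeRepHom_mul (T S : heckeAlgebra k Gᵥ Kᵥ) :
    h.localHeckeRepHom M ι (T * S) = h.localHeckeRepHom M ι T ≫ h.localHeckeRepHom M ι S :=
  Rep.hom_ext (Representation.IntertwiningMap.ext (h.localHeckeFun_mul (k := k) (M := M) T S))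

/-- **The operator of `T ∈ ℋ(Gᵥ, Kᵥ)` on `H^i(X_L, M)`** (functoriality of group cohomology
applied to `localHeckeRepHom`): the action of the local Hecke algebra at the unramified place `v`
on the cohomology of the arithmetic quotient of level `L` ([Scholze2015, §V.4];
[TreumannVenkatesh2016, §2.11, §5]). [cite: Scholze2015, §V.4] -/
abbrev localHeckeOperator (T : heckeAlgebra k Gᵥ Kᵥ) (i : ℕ) :
    cohomology k ι L M i ⟶ cohomology k ι L M i :=
  groupCohomology.map (MonoidHom.id Γ) (h.localHeckeRepHom M ι T) i

/-- The operator of `T ∈ ℋ(Gᵥ, Kᵥ)` on `H^i(X_L, M)` as a `k`-linear endomorphism. [folklore] -/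
abbrev localHeckeEnd (T : heckeAlgebra k Gᵥ Kᵥ) (i : ℕ) : Module.End k (cohomology k ι L M i) :=
  (h.localHeckeOperator M ι T i).hom

/-- Additivity of `T ↦ T|H^i`. [folklore] -/
theorem localHeckeEnd_add (S T : heckeAlgebra k Gᵥ Kᵥ) (i : ℕ) :
    h.localHeckeEnd M ι (S + T) i = h.localHeckeEnd M ι S i + h.localHeckeEnd M ι T i := by
  -- additivity of `Hⁱ(Γ, -)` on morphisms (inhomogeneous cochains and homology are additive;
  -- cf. `TwistedQuotient.map_id_add` of `CuspidalCohomologyGLShapiroSum`, not imported here)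
  have hadd : ∀ {A B : Rep k Γ} (φ ψ : A ⟶ B), groupCohomology.map (MonoidHom.id Γ) (φ + ψ) i =
      groupCohomology.map (MonoidHom.id Γ) φ i + groupCohomology.map (MonoidHom.id Γ) ψ i := by
    intro A B φ ψ
    have hc : groupCohomology.cochainsMap (MonoidHom.id Γ) (φ + ψ) =
        groupCohomology.cochainsMap (MonoidHom.id Γ) φ +
          groupCohomology.cochainsMap (MonoidHom.id Γ) ψ :=
      (groupCohomology.cochainsFunctor k Γ).map_add
    change (HomologicalComplex.homologyMap
        (groupCohomology.cochainsMap (MonoidHom.id Γ) (φ + ψ)) i :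
        (groupCohomology.inhomogeneousCochains A).homology i ⟶
          (groupCohomology.inhomogeneousCochains B).homology i) =
      HomologicalComplex.homologyMap (groupCohomology.cochainsMap (MonoidHom.id Γ) φ) i +
        HomologicalComplex.homologyMap (groupCohomology.cochainsMap (MonoidHom.id Γ) ψ) i
    rw [hc, HomologicalComplex.homologyMap_add]
  unfold localHeckeEnd localHeckeOperator
  rw [h.localHeckeRepHom_add M ι S T, hadd, ModuleCat.hom_add]

/-- Homogeneity of `T ↦ T|H^i`. [folklore] -/
theorem localHeckeEnd_smul (r : k) (T : heckeAlgebra k Gᵥ Kᵥ) (i : ℕ) :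
    h.localHeckeEnd M ι (r • T) i = r • h.localHeckeEnd M ι T i := by
  unfold localHeckeEnd localHeckeOperator
  rw [h.localHeckeRepHom_smul M ι r T, groupCohomology_map_id_smul, ModuleCat.hom_smul]

/-- `1|H^i = id`. [folklore] -/
theorem localHeckeEnd_one (i : ℕ) : h.localHeckeEnd M ι (1 : heckeAlgebra k Gᵥ Kᵥ) i = 1 := by
  unfold localHeckeEnd localHeckeOperator
  rw [h.localHeckeRepHom_one M ι, groupCohomology.map_id]
  rfl

/-- **Anti-multiplicativity on `H^i`**: `(T S)|H^i = S|H^i ∘ T|H^i`. [folklore] -/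
theorem localHeckeEnd_mul (T S : heckeAlgebra k Gᵥ Kᵥ) (i : ℕ) :
    h.localHeckeEnd M ι (T * S) i = h.localHeckeEnd M ι S i * h.localHeckeEnd M ι T i := by
  unfold localHeckeEnd localHeckeOperator
  rw [h.localHeckeRepHom_mul M ι T S, groupCohomology.map_id_comp, ModuleCat.hom_comp]
  rfl

/-- On `H^i`, the basis element `T_{KᵥaKᵥ}` acts as the tree's Hecke operator `T_{ιᵥ(a)}`
(`ArithmeticQuotient.heckeEnd`). [cite: KhareThorne2017, §6.2] -/
theorem localHeckeEnd_doubleCosetOperator [IsHeckeTriple (⊤ : Submonoid Gᵥ) Kᵥ Kᵥ] (a : Gᵥ)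
    (i : ℕ) :
    h.localHeckeEnd M ι (heckeAlgebra.doubleCosetOperator Kᵥ a) i = heckeEnd k L (ιᵥ a) M ι i := by
  have hrep : h.localHeckeRepHom M ι (heckeAlgebra.doubleCosetOperator Kᵥ a) =
      heckeRepHom k L (ιᵥ a) M ι :=
    Rep.hom_ext (Representation.IntertwiningMap.ext
      (h.localHeckeFun_doubleCosetOperator (k := k) (M := M) a))
  unfold localHeckeEnd localHeckeOperator
  rw [hrep]

/-- The `k`-linear map `T ↦ T|H^i(X_L, M)`. [folklore] -/
def localHeckeEndLinear (i : ℕ) :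
    heckeAlgebra k Gᵥ Kᵥ →ₗ[k] Module.End k (cohomology k ι L M i) where
  toFun T := h.localHeckeEnd M ι T i
  map_add' S T := h.localHeckeEnd_add M ι S T i
  map_smul' r T := h.localHeckeEnd_smul M ι r T i

/-- Unfolding lemma for `localHeckeEndLinear`. [folklore] -/
@[simp]
theorem localHeckeEndLinear_apply (i : ℕ) (T : heckeAlgebra k Gᵥ Kᵥ) :
    localHeckeEndLinear M h ι i T = h.localHeckeEnd M ι T i :=
  rfl

/-- **The action of the local Hecke algebra on `H^i(X_L, M)` as a `k`-algebra homomorphism**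
`ℋ(Gᵥ, Kᵥ)ᵐᵒᵖ →ₐ[k] End_k H^i(X_L, M)`, `op T ↦ T|H^i`, for a level `L` unramified at `v`: the
"canonical action" of `𝕋_v` on `H^i(X_K, ·)` of [Scholze2015, §V.4] and the left
`ℋ(G_v, K_v)`-module structure on `H^*([G]_K)` of [TreumannVenkatesh2016, §2.11, §5 (Def. 2)].
The `ᵐᵒᵖ` records that the tree's `heckeAlgebra = End_G(k[G ⧸ K])` (composition) is
anti-isomorphic to the convolution algebra `C_c(K\G/K)` (`HeckeAlgebra`, module docstring), whose
element `𝟙_{KaK}` acts by `f ↦ ∑_{yK ⊆ KaK} f(· y)` (`localHeckeEnd_doubleCosetOperator`); for the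
commutative spherical algebras of `GL_N` this is immaterial for characters.
[cite: Scholze2015, §V.4] -/
def localHeckeAlgHom (i : ℕ) :
    (heckeAlgebra k Gᵥ Kᵥ)ᵐᵒᵖ →ₐ[k] Module.End k (cohomology k ι L M i) :=
  AlgHom.ofLinearMap (localHeckeEndLinear M h ι i ∘ₗ (MulOpposite.opLinearEquiv k).symm.toLinearMap)
    (by simpa using h.localHeckeEnd_one M ι i)
    (fun S T => by simpa using h.localHeckeEnd_mul M ι T.unop S.unop i)

/-- Unfolding lemma: `op T` acts by `T|H^i`. [folklore] -/
@[simp]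
theorem localHeckeAlgHom_op (i : ℕ) (T : heckeAlgebra k Gᵥ Kᵥ) :
    localHeckeAlgHom M h ι i (MulOpposite.op T) = h.localHeckeEnd M ι T i :=
  rfl

end IsUnramifiedLevel

section OrthogonalCohomology

variable {G₁ G₂ : Type*} [Group G₁] [Group G₂] {K₁ : Subgroup G₁} {K₂ : Subgroup G₂}
  {ι₁ : G₁ →* 𝒢} {π₁ : 𝒢 →* G₁} {ι₂ : G₂ →* 𝒢} {π₂ : 𝒢 →* G₂} {L : Subgroup 𝒢}
  {Γ : Type u} [Group Γ] (ι : Γ →* 𝒢)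

variable (k M) in
/-- **On `H^i(X_L, M)` the local Hecke algebras at two different unramified places commute.**
[folklore] -/
theorem localHeckeEnd_comm_of_orthogonal (h₁ : IsUnramifiedLevel K₁ ι₁ π₁ L)
    (h₂ : IsUnramifiedLevel K₂ ι₂ π₂ L) (horth : ∀ y : G₁, π₂ (ι₁ y) = 1)
    (T₁ : heckeAlgebra k G₁ K₁) (T₂ : heckeAlgebra k G₂ K₂) (i : ℕ) :
    h₁.localHeckeEnd M ι T₁ i * h₂.localHeckeEnd M ι T₂ i =
      h₂.localHeckeEnd M ι T₂ i * h₁.localHeckeEnd M ι T₁ i := by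
  have hrep : h₂.localHeckeRepHom M ι T₂ ≫ h₁.localHeckeRepHom M ι T₁ =
      h₁.localHeckeRepHom M ι T₁ ≫ h₂.localHeckeRepHom M ι T₂ :=
    Rep.hom_ext (Representation.IntertwiningMap.ext
      (localHeckeFun_comm_of_orthogonal k M h₁ h₂ horth T₁ T₂))
  have h12 :=
    groupCohomology.map_id_comp (h₂.localHeckeRepHom M ι T₂) (h₁.localHeckeRepHom M ι T₁) i
  rw [hrep, groupCohomology.map_id_comp] at h12
  have h' := congrArg ModuleCat.Hom.hom h12
  rw [ModuleCat.hom_comp, ModuleCat.hom_comp] at h'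
  exact h'.symm

end OrthogonalCohomology

end ArithmeticQuotient

/-! ## `GL_N` over a number field: `H^i(X_K, k)` as a module over
`⊗_{v ∈ V} ℋ(GL_N(F_v), GL_N(𝒪_v); k)`, and Hecke eigensystems occurring in it -/

open scoped NumberField
open IsDedekindDomain BigHeckeGLn

namespace ModPHeckeEigensystemGL

variable (N : ℕ) (F : Type) [Field F] [NumberField F] (k : Type) [CommRing k]

/-- **The spherical Hecke algebra `ℋ(GL_N(F_v), GL_N(𝒪_v); k)`** at the finite place `v` of the
number field `F` with coefficients in `k`: the tree's `heckeAlgebra k G K = End_G(k[G ⧸ K])`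
(`HeckeAlgebra`) for `G = GL_N(F_v)` (`v.adicCompletion F`) and `K = GL_N(𝒪_v) = glInt N F_v`
(`ReductiveGroupData`; the `ValuativeRel` structure of `F_v` is that of `AdicCompletionLocalField`),
the algebra on which the tree's mod-`p` Satake transform and Satake parameters
(`satakeTransformModP`, `IsSatakeParameterModP`) and the normalized Brauer homomorphism
(`heckeAlgebra.normalizedBrauerAlgHom`) live.  This is `𝕋_v ⊗ k` for Scholze's
`𝕋_v = ℤ_p[GL_n(F_v) // GL_n(𝒪_{F_v})]` [Scholze2015, §V.4] and Treumann–Venkatesh's `ℋ(G_v, K_v)`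
[TreumannVenkatesh2016, §2.10, §5]. [cite: Scholze2015, §V.4] -/
abbrev localHeckeAlgebra (v : HeightOneSpectrum (𝓞 F)) :
    Subalgebra k (Module.End k
      (MonoidAlgebra k (GL (Fin N) (v.adicCompletion F) ⧸ glInt N (v.adicCompletion F)))) :=
  heckeAlgebra k (GL (Fin N) (v.adicCompletion F)) (glInt N (v.adicCompletion F))

/-- **`k`-characters of the global unramified Hecke algebra `⊗'_v ℋ(GL_N(F_v), GL_N(𝒪_v); k)`**,
typed as families `θ = (θ_v)_v` of `k`-algebra homomorphisms `θ_v : ℋ(GL_N(F_v), GL_N(𝒪_v); k) → k`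
indexed by ALL finite places (the components at the places one excludes are simply never used):
a `k`-algebra homomorphism out of a restricted tensor product `⊗'_{v ∈ V} ℋ_v` of unital
`k`-algebras (restricted with respect to the units, [TreumannVenkatesh2016, §5, Def. 2]) into the
commutative ring `k` is the same as a family of homomorphisms `ℋ_v → k`, `v ∈ V` (its restrictions
along `ℋ_v → ⊗'_w ℋ_w`); this is Scholze's "system of Hecke eigenvalues `ψ : 𝕋_{F,S} → 𝔽̄_p`"
[Scholze2015, Cor. V.4.3] and Treumann–Venkatesh's "character `χ` of `ℋ(G_V, K_V)`"
[TreumannVenkatesh2016, §5.2]. [cite: TreumannVenkatesh2016, §5, Def. 2 and §5.2] -/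
abbrev HeckeCharacter : Type :=
  ∀ v : HeightOneSpectrum (𝓞 F), localHeckeAlgebra N F k v →ₐ[k] k

/-- **`H^i(X_K, k)`** for `GL_N` over the number field `F`, a level `K ≤ GL_N(𝔸_F^∞)` and a
commutative coefficient ring `k`: the cohomology of the locally symmetric space
`X_K = GL_N(F) \ [(GL_N(F ⊗ ℝ)/ℝ_{>0} K_∞) × GL_N(𝔸_{F,f})/K]` regarded as a quotient STACK when `K`
is not neat [Scholze2015, §V.4, before Thm. V.4.1] (= Treumann–Venkatesh's `[G]_K`,
[TreumannVenkatesh2016, §5, Def. 2], as an orbifold), i.e. — the symmetric space being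
contractible — the group cohomology `H^i(GL_N(F), Fun(GL_N(𝔸_{F,f}) ⧸ K, k))`: the tree's
`ArithmeticQuotient.cohomology` for the diagonal embedding `BigHeckeGLn.globalEmbedding N F`
(the same object as in `HeckeEigenvaluesOccurGL` of `ScholzeTorsionGalois`, where the embedding is
spelled out as `GeneralLinearGroup.map (algebraMap F 𝔸_{F,f})`). [cite: Scholze2015, §V.4] -/
abbrev cohomology (K : Subgroup (FiniteAdelicGL N F)) (i : ℕ) : ModuleCat k :=
  ArithmeticQuotient.cohomology k (globalEmbedding N F) K k i

/-- **The level `K` is maximal (hyperspecial) at the places of `V`**: for every `v ∈ V`,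
`K ⊇ ιᵥ(GL_N(𝒪_v))` and the `v`-components of the elements of `K` lie in `GL_N(𝒪_v)`, so that
place by place `K = K^{(v)} · ιᵥ(GL_N(𝒪_v))` with `K^{(v)}` the elements of trivial `v`-component
(`IsUnramifiedLevel.mul_inv_mem`): Scholze's `K = K_S K^S`, `K^S = ∏_{v ∉ S} GL_n(𝒪_{F_v})`, with
`V = {v ∉ S}` [Scholze2015, §V.4], and condition (iii) ("`K_v` is hyperspecial") of a good place in
[TreumannVenkatesh2016, §5.1]; formally `ArithmeticQuotient.IsUnramifiedLevel` for the place datum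
`(GL_N(F_v), GL_N(𝒪_v), BigHeckeGLn.ofLocal, BigHeckeGLn.localComponent)`, whose two structural
conditions always hold (`isMaximalOn_of_le`).  Nothing is required at the places outside `V`
(no compactness/openness: those enter the theorems, not the definitions).
[cite: Scholze2015, §V.4] -/
def IsMaximalOn (V : Set (HeightOneSpectrum (𝓞 F))) (K : Subgroup (FiniteAdelicGL N F)) : Prop :=
  ∀ v ∈ V, ArithmeticQuotient.IsUnramifiedLevel (glInt N (v.adicCompletion F)) (ofLocal N F v)
    (localComponent N F v) K

variable {N F k}

/-- Maximality on `V` is inherited by subsets of `V`. [folklore] -/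
theorem IsMaximalOn.mono {V V' : Set (HeightOneSpectrum (𝓞 F))} {K : Subgroup (FiniteAdelicGL N F)}
    (hVV' : V' ⊆ V) (h : IsMaximalOn N F V K) : IsMaximalOn N F V' K :=
  fun v hv => h v (hVV' hv)

/-- **Criterion**: `K` is maximal on `V` as soon as `ιᵥ(GL_N(𝒪_v)) ≤ K` and `pr_v(K) ≤ GL_N(𝒪_v)`
for `v ∈ V` (the retraction and commutation conditions hold in the restricted product,
`BigHeckeGLn.localComponent_ofLocal`, `BigHeckeGLn.mul_ofLocal_comm`). [folklore] -/
theorem isMaximalOn_of_le {V : Set (HeightOneSpectrum (𝓞 F))} {K : Subgroup (FiniteAdelicGL N F)}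
    (h₁ : ∀ v ∈ V, (glInt N (v.adicCompletion F)).map (ofLocal N F v) ≤ K)
    (h₂ : ∀ v ∈ V, K ≤ (glInt N (v.adicCompletion F)).comap (localComponent N F v)) :
    IsMaximalOn N F V K :=
  fun v hv =>
    { apply_apply := localComponent_ofLocal
      comm_of_apply_eq_one := fun _ hx => mul_ofLocal_comm hx
      map_le := h₁ v hv
      le_comap := h₂ v hv }

variable (N F k)

open scoped Classical in
/-- **The operator of `T ∈ ℋ(GL_N(F_v), GL_N(𝒪_v); k)` on `H^i(X_K, k)`** for a level `K` maximal
at `v`: `IsUnramifiedLevel.localHeckeEnd`, i.e. on the coefficients `Fun(GL_N(𝔸_{F,f}) ⧸ K, k)`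
the operator `(T f)(xK) = ∑_{y GL_N(𝒪_v)} (T [GL_N(𝒪_v)])(y) · f(x ιᵥ(y) K)`, transported to
`H^i` by functoriality; the double-coset basis element `T_{GL_N(𝒪_v) a GL_N(𝒪_v)}` acts by the
tree's Hecke operator `[K ιᵥ(a) K]`, `f ↦ ∑_{hK ⊆ K ιᵥ(a) K} f(· h)`
(`heckeEnd_doubleCosetOperator`) — the canonical action of `𝕋_v` [Scholze2015, §V.4], the left
`ℋ(G_v, K_v)`-action on `H^*([G]_K)`
[TreumannVenkatesh2016, §2.11, §5].  JUNK VALUE `0` when `K` is not maximal at `v`. The assignment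
`T ↦ heckeEnd K v T i` is `k`-linear, unital and ANTI-multiplicative (`heckeAlgHom`).
[cite: Scholze2015, §V.4] -/
def heckeEnd (K : Subgroup (FiniteAdelicGL N F)) (v : HeightOneSpectrum (𝓞 F))
    (T : localHeckeAlgebra N F k v) (i : ℕ) : Module.End k (cohomology N F k K i) :=
  if h : ArithmeticQuotient.IsUnramifiedLevel (glInt N (v.adicCompletion F)) (ofLocal N F v)
      (localComponent N F v) K
  then h.localHeckeEnd k (globalEmbedding N F) T i else 0

variable {N F k}

/-- At a place where `K` is maximal, `heckeEnd` is the honest operator `localHeckeEnd`.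
[folklore] -/
theorem heckeEnd_eq {K : Subgroup (FiniteAdelicGL N F)} {v : HeightOneSpectrum (𝓞 F)}
    (h : ArithmeticQuotient.IsUnramifiedLevel (glInt N (v.adicCompletion F)) (ofLocal N F v)
      (localComponent N F v) K)
    (T : localHeckeAlgebra N F k v) (i : ℕ) :
    heckeEnd N F k K v T i = h.localHeckeEnd k (globalEmbedding N F) T i :=
  dif_pos h

/-- The documented junk value: `heckeEnd = 0` at a place where `K` is not maximal. [folklore] -/
theorem heckeEnd_of_not {K : Subgroup (FiniteAdelicGL N F)} {v : HeightOneSpectrum (𝓞 F)}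
    (h : ¬ ArithmeticQuotient.IsUnramifiedLevel (glInt N (v.adicCompletion F)) (ofLocal N F v)
      (localComponent N F v) K)
    (T : localHeckeAlgebra N F k v) (i : ℕ) : heckeEnd N F k K v T i = 0 :=
  dif_neg h

section Action

variable {V : Set (HeightOneSpectrum (𝓞 F))} {K : Subgroup (FiniteAdelicGL N F)}

variable (k) in
/-- **`H^i(X_K, k)` as a module over `ℋ(GL_N(F_v), GL_N(𝒪_v); k)`, `v ∈ V`, for a level maximal on
`V`**: the `k`-algebra homomorphism `ℋ(GL_N(F_v), GL_N(𝒪_v); k)ᵐᵒᵖ →ₐ[k] End_k H^i(X_K, k)`,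
`op T ↦ heckeEnd K v T i` (`IsUnramifiedLevel.localHeckeAlgHom`).  Together with the commutation of
different places (`heckeEnd_comm_of_ne`) these homomorphisms are the "canonical action of
`𝕋_{F,S} = ⊗_{v ∉ S} 𝕋_v` on `H^i(X_K, ·)`" of [Scholze2015, §V.4] and the action of
`ℋ(G_V, K_V) = ⊗'_{v ∈ V} ℋ(G_v, K_v)` on `H^*([G]_K)` of [TreumannVenkatesh2016, §5];
the `ᵐᵒᵖ` is explained on `IsUnramifiedLevel.localHeckeAlgHom` (immaterial for characters of the
commutative algebras `ℋ(GL_N(F_v), GL_N(𝒪_v); k)`). [cite: Scholze2015, §V.4] -/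
def heckeAlgHom (hK : IsMaximalOn N F V K) {v : HeightOneSpectrum (𝓞 F)} (hv : v ∈ V) (i : ℕ) :
    (localHeckeAlgebra N F k v)ᵐᵒᵖ →ₐ[k] Module.End k (cohomology N F k K i) :=
  (hK v hv).localHeckeAlgHom k (globalEmbedding N F) i

/-- `heckeAlgHom` on `op T` is `heckeEnd K v T i`. [folklore] -/
@[simp]
theorem heckeAlgHom_op (hK : IsMaximalOn N F V K) {v : HeightOneSpectrum (𝓞 F)} (hv : v ∈ V)
    (i : ℕ) (T : localHeckeAlgebra N F k v) :
    heckeAlgHom k hK hv i (MulOpposite.op T) = heckeEnd N F k K v T i := by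
  rw [heckeEnd_eq (hK v hv)]
  rfl

/-- `1 ∈ ℋ_v` acts as the identity (at a place where `K` is maximal). [folklore] -/
theorem heckeEnd_one (hK : IsMaximalOn N F V K) {v : HeightOneSpectrum (𝓞 F)} (hv : v ∈ V)
    (i : ℕ) : heckeEnd N F k K v (1 : localHeckeAlgebra N F k v) i = 1 := by
  rw [heckeEnd_eq (hK v hv)]
  exact (hK v hv).localHeckeEnd_one k (globalEmbedding N F) i

/-- `T ↦ heckeEnd K v T i` is additive. [folklore] -/
theorem heckeEnd_add (hK : IsMaximalOn N F V K) {v : HeightOneSpectrum (𝓞 F)} (hv : v ∈ V)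
    (S T : localHeckeAlgebra N F k v) (i : ℕ) :
    heckeEnd N F k K v (S + T) i = heckeEnd N F k K v S i + heckeEnd N F k K v T i := by
  simp only [heckeEnd_eq (hK v hv)]
  exact (hK v hv).localHeckeEnd_add k (globalEmbedding N F) S T i

/-- `T ↦ heckeEnd K v T i` is `k`-homogeneous. [folklore] -/
theorem heckeEnd_smul (hK : IsMaximalOn N F V K) {v : HeightOneSpectrum (𝓞 F)} (hv : v ∈ V)
    (r : k) (T : localHeckeAlgebra N F k v) (i : ℕ) :
    heckeEnd N F k K v (r • T) i = r • heckeEnd N F k K v T i := by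
  simp only [heckeEnd_eq (hK v hv)]
  exact (hK v hv).localHeckeEnd_smul k (globalEmbedding N F) r T i

/-- **Anti-multiplicativity**: `heckeEnd (T S) = heckeEnd S ∘ heckeEnd T`. [folklore] -/
theorem heckeEnd_mul (hK : IsMaximalOn N F V K) {v : HeightOneSpectrum (𝓞 F)} (hv : v ∈ V)
    (T S : localHeckeAlgebra N F k v) (i : ℕ) :
    heckeEnd N F k K v (T * S) i = heckeEnd N F k K v S i * heckeEnd N F k K v T i := by
  simp only [heckeEnd_eq (hK v hv)]
  exact (hK v hv).localHeckeEnd_mul k (globalEmbedding N F) T S i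

/-- **Different places commute** on `H^i(X_K, k)` (`localHeckeEnd_comm_of_orthogonal`; the
components `(ιᵥ y)_w = 1` for `w ≠ v`, `BigHeckeGLn.localComponent_ofLocal_of_ne`). [folklore] -/
theorem heckeEnd_comm_of_ne (hK : IsMaximalOn N F V K) {v w : HeightOneSpectrum (𝓞 F)}
    (hv : v ∈ V) (hw : w ∈ V) (hvw : v ≠ w) (T : localHeckeAlgebra N F k v)
    (T' : localHeckeAlgebra N F k w) (i : ℕ) :
    heckeEnd N F k K v T i * heckeEnd N F k K w T' i =
      heckeEnd N F k K w T' i * heckeEnd N F k K v T i := by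
  rw [heckeEnd_eq (hK v hv), heckeEnd_eq (hK w hw)]
  exact ArithmeticQuotient.localHeckeEnd_comm_of_orthogonal k k (globalEmbedding N F) (hK v hv)
    (hK w hw) (fun y => localComponent_ofLocal_of_ne (Ne.symm hvw) y) T T' i

/-- **The same place commutes** as soon as `ℋ(GL_N(F_v), GL_N(𝒪_v); k)` is commutative
(`IsGelfandPair`; for `GL_N` this is Gelfand's trick with the transpose, the tree's
`IsGelfandPair.of_antiInvolution` / `SatakeParametersGL.isGelfandPair_glInt_holds`). [folklore] -/
theorem heckeEnd_comm_of_isGelfandPair {v : HeightOneSpectrum (𝓞 F)}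
    (hcomm : IsGelfandPair k (GL (Fin N) (v.adicCompletion F)) (glInt N (v.adicCompletion F)))
    (hK : IsMaximalOn N F V K) (hv : v ∈ V) (T T' : localHeckeAlgebra N F k v) (i : ℕ) :
    heckeEnd N F k K v T i * heckeEnd N F k K v T' i =
      heckeEnd N F k K v T' i * heckeEnd N F k K v T i := by
  rw [← heckeEnd_mul hK hv, hcomm T' T, heckeEnd_mul hK hv]

/-- At a maximal place the double-coset basis element `T_{GL_N(𝒪_v) a GL_N(𝒪_v)}` of `ℋ_v` acts on
`H^i(X_K, k)` as the tree's global Hecke operator `T_{ιᵥ(a)} = [K ιᵥ(a) K]`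
(`ArithmeticQuotient.heckeEnd`, the operator of `HeckeEigenvaluesOccurGL` and
`BigHeckeGLn.heckeOnCohomology`). [cite: KhareThorne2017, §6.2] -/
theorem heckeEnd_doubleCosetOperator {v : HeightOneSpectrum (𝓞 F)}
    [IsHeckeTriple (⊤ : Submonoid (GL (Fin N) (v.adicCompletion F))) (glInt N (v.adicCompletion F))
      (glInt N (v.adicCompletion F))]
    (h : ArithmeticQuotient.IsUnramifiedLevel (glInt N (v.adicCompletion F)) (ofLocal N F v)
      (localComponent N F v) K)
    (a : GL (Fin N) (v.adicCompletion F)) (i : ℕ) :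
    heckeEnd N F k K v (heckeAlgebra.doubleCosetOperator (glInt N (v.adicCompletion F)) a) i =
      ArithmeticQuotient.heckeEnd k K (ofLocal N F v a) k (globalEmbedding N F) i := by
  rw [heckeEnd_eq h]
  exact h.localHeckeEnd_doubleCosetOperator k (globalEmbedding N F) a i

end Action

variable (N F k)

/-- **Scholze's Hecke algebra `𝕋(K, i)` of level `K` in degree `i`**: the `k`-subalgebra of
`End_k(H^i(X_K, k))` generated by the operators of all `T ∈ ℋ(GL_N(F_v), GL_N(𝒪_v); k)`, `v ∈ V`
(`heckeEnd`), i.e. the image of `⊗_{v ∈ V} ℋ_v → End_k(H^i(X_K, k))` — for `k = ℤ/p^m`,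
`V = {v ∉ S}`
and trivial weight this is `𝕋_{F,S}(K, i, m) = im(𝕋_{F,S} → End_{ℤ/p^m}(H^i(X_K, ℤ/p^mℤ)))` of
[Scholze2015, Thm. V.4.1 and its proof] (the map from `𝕋_v = ℤ_p[G//K]`, free on the double cosets,
factors through `𝕋_v ⊗ ℤ/p^m = ℋ(G, K; ℤ/p^m)`, so the images agree).
[cite: Scholze2015, Thm. V.4.1] -/
def heckeImage (V : Set (HeightOneSpectrum (𝓞 F))) (K : Subgroup (FiniteAdelicGL N F)) (i : ℕ) :
    Subalgebra k (Module.End k (cohomology N F k K i)) :=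
  Algebra.adjoin k {φ | ∃ v ∈ V, ∃ T : localHeckeAlgebra N F k v, heckeEnd N F k K v T i = φ}

variable {N F k} in
/-- The operators `heckeEnd K v T i`, `v ∈ V`, lie in `𝕋(K, i)`. [folklore] -/
theorem heckeEnd_mem_heckeImage {V : Set (HeightOneSpectrum (𝓞 F))}
    {K : Subgroup (FiniteAdelicGL N F)}
    {v : HeightOneSpectrum (𝓞 F)} (hv : v ∈ V) (T : localHeckeAlgebra N F k v) (i : ℕ) :
    heckeEnd N F k K v T i ∈ heckeImage N F k V K i :=
  Algebra.subset_adjoin ⟨v, hv, T, rfl⟩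

end ModPHeckeEigensystemGL

section Eigensystem

variable (N : ℕ) (F : Type) [Field F] [NumberField F] (k : Type) [CommRing k]

/-- **A mod-`p` (more generally: `k`-valued) Hecke eigensystem of `GL_N` over `F` occurring in
`H^i(X_K, k)`, with the places in `V` imposed**: a `k`-character `θ = (θ_v)_v` of the unramified
Hecke algebra `⊗'_v ℋ(GL_N(F_v), GL_N(𝒪_v); k)` (`ModPHeckeEigensystemGL.HeckeCharacter`) together
with a NON-ZERO class `c ∈ H^i(X_K, k)` (`ModPHeckeEigensystemGL.cohomology`) such that
`T · c = θ_v(T) · c` for every `v ∈ V` and every `T ∈ ℋ(GL_N(F_v), GL_N(𝒪_v); k)`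
(`ModPHeckeEigensystemGL.heckeEnd`).  This is a "mod `p` automorphic form for `GL_N`" in the sense
of [TreumannVenkatesh2016, §1.1] ("Hecke eigenclasses in the cohomology of congruence subgroups with
`k`-coefficients") for the places `V`, and, for `V = {v ∉ S}` and `k = 𝔽̄_p`, a system of Hecke
eigenvalues `ψ : 𝕋_{F,S} → 𝔽̄_p` with `H^i(X_K, 𝔽̄_p)[ψ] ≠ 0` [Scholze2015, Cor. V.4.3].  The
predicates `ModPHeckeEigensystemGL.OccursInDegree` / `OccursIn` say that a given `θ` so occurs in
degree `i` / in some degree. [cite: TreumannVenkatesh2016, §1.1 and §5.2] -/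
structure ModPHeckeEigensystemGL (V : Set (HeightOneSpectrum (𝓞 F)))
    (K : Subgroup (BigHeckeGLn.FiniteAdelicGL N F)) (i : ℕ) where
  /-- The system of Hecke eigenvalues: a `k`-character of `ℋ(GL_N(F_v), GL_N(𝒪_v); k)` for each `v`
  (only the components at `v ∈ V` matter). -/
  θ : ModPHeckeEigensystemGL.HeckeCharacter N F k
  /-- The eigenclass `c ∈ H^i(X_K, k)`. -/
  cl : ModPHeckeEigensystemGL.cohomology N F k K i
  /-- The eigenclass is non-zero. -/
  cl_ne_zero : cl ≠ 0
  /-- `T · c = θ_v(T) · c` for `v ∈ V` and `T ∈ ℋ(GL_N(F_v), GL_N(𝒪_v); k)`. -/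
  eigen : ∀ v ∈ V, ∀ T : ModPHeckeEigensystemGL.localHeckeAlgebra N F k v,
    ModPHeckeEigensystemGL.heckeEnd N F k K v T i cl = θ v T • cl

namespace ModPHeckeEigensystemGL

/-- **The character `θ` of `⊗'_{v ∈ V} ℋ(GL_N(F_v), GL_N(𝒪_v); k)` occurs in `H^i(X_K, k)`**: there
is a non-zero `c ∈ H^i(X_K, k)` with `T · c = θ_v(T) · c` for all `v ∈ V`, `T ∈ ℋ_v` — "the
`ψ`-eigenspace `H^i(X_K, ·)[ψ]` is non-zero" [Scholze2015, Cor. V.4.3]; "there is `h ∈ H^i([G]_K)`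
such that `h` transforms under `ℋ(G_V, K_V)` by `χ`" [TreumannVenkatesh2016, §5.2] (in one degree;
all degrees: `OccursIn`).  Meaningful for levels `K` maximal on `V` (`IsMaximalOn`); by the junk
convention of `heckeEnd` it is `False` otherwise (`OccursInDegree.isMaximalOn`).
[cite: TreumannVenkatesh2016, §5.2] -/
def OccursInDegree (V : Set (HeightOneSpectrum (𝓞 F))) (K : Subgroup (FiniteAdelicGL N F)) (i : ℕ)
    (θ : HeckeCharacter N F k) : Prop :=
  ∃ c : cohomology N F k K i, c ≠ 0 ∧
    ∀ v ∈ V, ∀ T : localHeckeAlgebra N F k v, heckeEnd N F k K v T i c = θ v T • c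

/-- **The character `θ` occurs in the cohomology `H^*(X_K, k)`** (in some degree):
Treumann–Venkatesh's
"`χ` appears in the cohomology of `[G]_K`" [TreumannVenkatesh2016, §5.2] (an eigenvector `h ∈ H^*`
may be taken homogeneous, the Hecke action preserving degrees), the notion in which the First Main
Theorem [TreumannVenkatesh2016, §5.5, Thm. 5] is stated. [cite: TreumannVenkatesh2016, §5.2] -/
def OccursIn (V : Set (HeightOneSpectrum (𝓞 F))) (K : Subgroup (FiniteAdelicGL N F))
    (θ : HeckeCharacter N F k) : Prop :=
  ∃ i : ℕ, OccursInDegree N F k V K i θ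

variable {N F k}
variable {V : Set (HeightOneSpectrum (𝓞 F))} {K : Subgroup (FiniteAdelicGL N F)} {i : ℕ}

/-- The eigensystem of a `ModPHeckeEigensystemGL` occurs (in its degree). [folklore] -/
theorem occursInDegree (E : ModPHeckeEigensystemGL N F k V K i) : OccursInDegree N F k V K i E.θ :=
  ⟨E.cl, E.cl_ne_zero, E.eigen⟩

/-- `θ` occurs in degree `i` iff it is the eigensystem of some `ModPHeckeEigensystemGL`.
[folklore] -/
theorem occursInDegree_iff {θ : HeckeCharacter N F k} :
    OccursInDegree N F k V K i θ ↔ ∃ E : ModPHeckeEigensystemGL N F k V K i, E.θ = θ := by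
  constructor
  · rintro ⟨c, hc, he⟩
    exact ⟨⟨θ, c, hc, he⟩, rfl⟩
  · rintro ⟨E, rfl⟩
    exact E.occursInDegree

/-- Occurrence in a degree implies occurrence. [folklore] -/
theorem OccursInDegree.occursIn {θ : HeckeCharacter N F k} (h : OccursInDegree N F k V K i θ) :
    OccursIn N F k V K θ :=
  ⟨i, h⟩

/-- Occurrence with the places `V` imposed implies occurrence for any smaller set of places
(fewer constraints; cf. the reduction to finite `V` in [TreumannVenkatesh2016, proof of Thm. 5]).
[folklore] -/
theorem OccursInDegree.mono {V' : Set (HeightOneSpectrum (𝓞 F))} (hVV' : V' ⊆ V)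
    {θ : HeckeCharacter N F k} (h : OccursInDegree N F k V K i θ) :
    OccursInDegree N F k V' K i θ := by
  obtain ⟨c, hc, he⟩ := h
  exact ⟨c, hc, fun v hv T => he v (hVV' hv) T⟩

/-- Occurrence in some degree is monotone in the set of imposed places. [folklore] -/
theorem OccursIn.mono {V' : Set (HeightOneSpectrum (𝓞 F))} (hVV' : V' ⊆ V)
    {θ : HeckeCharacter N F k} (h : OccursIn N F k V K θ) : OccursIn N F k V' K θ := by
  obtain ⟨i, hi⟩ := h
  exact ⟨i, hi.mono hVV'⟩

/-- An occurring character only matters through its components at the places of `V`. [folklore] -/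
theorem OccursInDegree.congr {θ θ' : HeckeCharacter N F k} (hθ : ∀ v ∈ V, θ v = θ' v)
    (h : OccursInDegree N F k V K i θ) : OccursInDegree N F k V K i θ' := by
  obtain ⟨c, hc, he⟩ := h
  exact ⟨c, hc, fun v hv T => hθ v hv ▸ he v hv T⟩

/-- **Occurrence forces the level to be maximal on `V`** (the junk convention of `heckeEnd`: at a
place where `K` is not maximal every `T`, in particular `T = 1`, acts by `0`, so an eigenclass would
satisfy `c = θ_v(1) c = 0`). [folklore] -/
theorem OccursInDegree.isMaximalOn {θ : HeckeCharacter N F k} (h : OccursInDegree N F k V K i θ) :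
    IsMaximalOn N F V K := by
  intro v hv
  by_contra hnot
  obtain ⟨c, hc, he⟩ := h
  have h1 := he v hv 1
  rw [heckeEnd_of_not hnot, map_one, one_smul, LinearMap.zero_apply] at h1
  exact hc h1.symm

/-- The eigen-equation of an occurring character for the operators of the algebra homomorphism
`heckeAlgHom` (`op T ↦ heckeEnd K v T i`). [folklore] -/
theorem OccursInDegree.exists_eigenvector {θ : HeckeCharacter N F k}
    (h : OccursInDegree N F k V K i θ) :
    ∃ c : cohomology N F k K i, c ≠ 0 ∧ ∀ (v : HeightOneSpectrum (𝓞 F)) (hv : v ∈ V)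
      (T : localHeckeAlgebra N F k v),
      heckeAlgHom k h.isMaximalOn hv i (MulOpposite.op T) c = θ v T • c := by
  obtain ⟨c, hc, he⟩ := h
  exact ⟨c, hc, fun v hv T => by rw [heckeAlgHom_op]; exact he v hv T⟩

end ModPHeckeEigensystemGL

end Eigensystem

end Literature.NumberTheory.Automorphic
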